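import Literature.Barriers.ResolutionOfSingularities.AccessibleInDim
import HarnessLib

/-!
# Sally's Example 4.6 completed: an accessible over-ring with an inaccessible intermediate
regular local ring

Sally [Sally1972, Ex. 4.6]: "An accessible extension of `R` can have a regular local subring which
is not accessible from `R`. Let `(R, M)` be an `n`-dimensional regular local ring, `n > 2`. Let
`M = (x, y, z, w_1, …, w_{n−3})`. Let `S = R[x/y, z/y, …]_Q` … `T = R[x/(y² + z³)]_N` where
`N = Q ∩ R[x/(y² + z³)]`. Then `R ⊂ T ⊂ S`, `S` is accessible from `R` and from `T`, but `T` is not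
accessible from `R`." (The example is Shannon's [Shannon1973].)

With the verbatim notions of `AccessibleInDim.lean` (`IsStrictSimpleExtension`,
`IsStrictlyAccessible`) and the rings of the barrier `LocalFactorizationFailsDimThree.lean`
(`Sally1972.R = k[x,y,z]_{(x,y,z)}`, `Sally1972.T = k[t,y,z]_{(t,y,z)}`, `x = t(y² + z³)`), this
file proves the sandwich for `n = 3` over every field `k`: writing `z = y·z₁` (so the base point is
`w = (t, y, z₁)`, algebraically independent), the regular local ring
`S = k[t, y, z₁]_{(t, y, z₁)} = T[z/y]_𝔭` is a strict simple extension of `T`, and is reached from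
`R` by the three strict simple extensions
`R = k[x,y,z]_{(x,y,z)} → R' = k[x₁,y,z]_{(x₁,y,z)} → R'' = k[x₁,y,z₁]_{(x₁,y,z₁)} → S`
(`x₁ = x/y`, `z₁ = z/y`, then `x₁/y = t(1 + y z₁³)`, a regular parameter of `S` times a unit),
while `T` is not accessible from `R` (`Sally1972.not_isStrictlyAccessible`, from
`Sally1972.div_not_mem_T`). Main statement: `Sally1972.exists_accessible_overring`.

Technique: every ring in sight is an `originLocalRing` (`Resolution/OriginLocalRing.lean`) at a
point obtained from `w` by substitutions `Xᵢ ↦ Xᵢ·g` with `g` free of `Xᵢ`, which are injective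
(`mulSubst_injective`, by inverting `g`) and hence preserve algebraic independence; a strict
simple extension between two such rings is recognised by `isStrictSimpleExtension_originLocalRing`.

## References
* [Sally1972] J. D. Sally, Regular overrings of regular local rings, Trans. AMS 171 (1972)
  291–300, Ex. 4.6.
* [Shannon1973] D. L. Shannon, Monoidal transforms of regular local rings, Amer. J. Math. 95
  (1973) 294–320.
-/

noncomputable section

open IsLocalRing

universe u v

namespace Literature.Barriers.ResolutionOfSingularities

open Literature.AlgebraicGeometry.Resolution
open _root_.MvPolynomial

/-! ### Substitutions `Xᵢ ↦ Xᵢ·g` -/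

section Subst

variable (k : Type u) [Field k]

/-- The `k`-algebra endomorphism of `k[X₀, X₁, X₂]` with `Xᵢ ↦ Xᵢ·g`, `Xⱼ ↦ Xⱼ` (`j ≠ i`) — an
affine chart of a blow-up when `g` is a coordinate. [folklore] -/
def mulSubst (i : Fin 3) (g : MvPolynomial (Fin 3) k) :
    MvPolynomial (Fin 3) k →ₐ[k] MvPolynomial (Fin 3) k :=
  aeval (Function.update X i (X i * g))

/-- `Xᵢ ↦ Xᵢ g`. [folklore] -/
@[simp] theorem mulSubst_X_self (i : Fin 3) (g : MvPolynomial (Fin 3) k) :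
    mulSubst k i g (X i) = X i * g := by
  simp [mulSubst]

/-- `Xⱼ ↦ Xⱼ` for `j ≠ i`. [folklore] -/
@[simp] theorem mulSubst_X_of_ne {i j : Fin 3} (g : MvPolynomial (Fin 3) k) (h : j ≠ i) :
    mulSubst k i g (X j) = X j := by
  simp [mulSubst, Function.update_of_ne h]

/-- **`Xᵢ ↦ Xᵢ·g` is injective when `g ≠ 0` does not involve `Xᵢ`**: after inverting `g` it has the
left inverse `Xᵢ ↦ Xᵢ/g`. [folklore] -/
theorem mulSubst_injective (i : Fin 3) {g : MvPolynomial (Fin 3) k} (hg0 : g ≠ 0)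
    (hvars : i ∉ g.vars) : Function.Injective (mulSubst k i g) := by
  have hF : algebraMap (MvPolynomial (Fin 3) k) (Localization.Away g) g *
      IsLocalization.Away.invSelf g = 1 :=
    IsLocalization.Away.mul_invSelf g
  let θ : Fin 3 → Localization.Away g :=
    Function.update (fun j => algebraMap (MvPolynomial (Fin 3) k) (Localization.Away g) (X j)) i
      (algebraMap (MvPolynomial (Fin 3) k) (Localization.Away g) (X i) *
        IsLocalization.Away.invSelf g)
  let ψ : MvPolynomial (Fin 3) k →ₐ[k] Localization.Away g := aeval θ
  have hψi : ψ (X i) = algebraMap (MvPolynomial (Fin 3) k) (Localization.Away g) (X i) *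
      IsLocalization.Away.invSelf g := by
    simp [ψ, θ]
  have hψj : ∀ j, j ≠ i →
      ψ (X j) = algebraMap (MvPolynomial (Fin 3) k) (Localization.Away g) (X j) := fun j hj => by
    simp [ψ, θ, Function.update_of_ne hj]
  have hψg : ψ g = algebraMap (MvPolynomial (Fin 3) k) (Localization.Away g) g := by
    refine hom_congr_vars (f₁ := (ψ : MvPolynomial (Fin 3) k →+* Localization.Away g))
      (f₂ := algebraMap (MvPolynomial (Fin 3) k) (Localization.Away g)) ?_ (fun j hj _ => ?_) rfl
    · refine RingHom.ext fun c => ?_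
      exact (ψ.commutes c).trans
        (IsScalarTower.algebraMap_apply k (MvPolynomial (Fin 3) k) (Localization.Away g) c)
    · exact hψj j (fun h => hvars (h ▸ hj))
  have hcomp : ψ.comp (mulSubst k i g) =
      IsScalarTower.toAlgHom k (MvPolynomial (Fin 3) k) (Localization.Away g) := by
    refine algHom_ext fun j => ?_
    by_cases hj : j = i
    · subst hj
      change ψ (mulSubst k j g (X j)) = algebraMap _ _ (X j)
      rw [mulSubst_X_self, map_mul, hψg, hψi, mul_assoc, mul_comm (IsLocalization.Away.invSelf _),
        hF, mul_one]
    · change ψ (mulSubst k i g (X j)) = algebraMap _ _ (X j)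
      rw [mulSubst_X_of_ne k g hj, hψj j hj]
  have hinj : Function.Injective
      (algebraMap (MvPolynomial (Fin 3) k) (Localization.Away g)) :=
    IsLocalization.injective (Localization.Away g)
      (powers_le_nonZeroDivisors_of_noZeroDivisors hg0)
  intro a b hab
  apply hinj
  have := congrArg ψ hab
  rwa [← AlgHom.comp_apply, ← AlgHom.comp_apply, hcomp] at this

variable {k} {L : Type v} [Field L] [Algebra k L]

/-- Algebraic independence is preserved by an injective substitution `Xᵢ ↦ Xᵢ·g`. [folklore] -/
theorem algebraicIndependent_mulSubst {w : Fin 3 → L} (hw : AlgebraicIndependent k w) (i : Fin 3)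
    {g : MvPolynomial (Fin 3) k} (hg0 : g ≠ 0) (hvars : i ∉ g.vars) :
    AlgebraicIndependent k (fun j => aeval w (mulSubst k i g (X j))) := by
  rw [algebraicIndependent_iff_injective_aeval] at hw ⊢
  have h : aeval (fun j => aeval w (mulSubst k i g (X j))) = (aeval w).comp (mulSubst k i g) :=
    algHom_ext fun j => by simp
  intro a b hab
  rw [h] at hab
  exact mulSubst_injective k i hg0 hvars (hw hab)

end Subst

/-! ### Strict simple extensions between algebraic local rings -/

section Step

variable {k : Type u} [Field k] {L : Type v} [Field L] [Algebra k L]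

/-- The maximal ideal of `k[P]_{(P)}` is `(P₀, P₁, P₂)` (cf. `Resolution.range_fin_three`, whose
module is not imported here to keep the import closure small). [folklore] -/
theorem maximalIdeal_originLocalRing_fin_three {P : Fin 3 → L} (hP : AlgebraicIndependent k P) :
    (haveI := isLocalRing_originLocalRing hP;
      maximalIdeal (originLocalRing hP)) =
      Ideal.span {originCoord hP 0, originCoord hP 1, originCoord hP 2} := by
  have hr : Set.range (originCoord hP) = {originCoord hP 0, originCoord hP 1, originCoord hP 2} := by
    ext a
    simp only [Set.mem_range, Set.mem_insert_iff, Set.mem_singleton_iff]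
    constructor
    · rintro ⟨i, rfl⟩
      fin_cases i <;> simp
    · rintro (rfl | rfl | rfl) <;> exact ⟨_, rfl⟩
  rw [maximalIdeal_originLocalRing, hr]

/-- The same with the generators listed as `(P₂, P₁, P₀)`. [folklore] -/
theorem maximalIdeal_originLocalRing_fin_three' {P : Fin 3 → L} (hP : AlgebraicIndependent k P) :
    (haveI := isLocalRing_originLocalRing hP;
      maximalIdeal (originLocalRing hP)) =
      Ideal.span {originCoord hP 2, originCoord hP 1, originCoord hP 0} := by
  rw [maximalIdeal_originLocalRing_fin_three]
  congr 1
  ext a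
  simp only [Set.mem_insert_iff, Set.mem_singleton_iff]
  tauto

/-- Polynomials in the point `P'` with coefficients in `k` lie in `A[u]` as soon as the
coordinates `P'ⱼ` do, for any `k`-subalgebra `A`. [folklore] -/
theorem aeval_mem_adjoinElem {A : Subalgebra k L} {u : L} {P' : Fin 3 → L}
    (hgen : ∀ j, P' j ∈ adjoinElem A.toSubring u) (F : MvPolynomial (Fin 3) k) :
    aeval P' F ∈ adjoinElem A.toSubring u := by
  induction F using MvPolynomial.induction_on with
  | C c =>
    rw [aeval_C]
    exact le_adjoinElem _ _ (A.algebraMap_mem c)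
  | add p q hp hq => rw [map_add]; exact Subring.add_mem _ hp hq
  | mul_X p j hp => rw [map_mul, aeval_X]; exact Subring.mul_mem _ hp (hgen j)

/-- **Recognising a strict simple extension between algebraic local rings.** Let
`A = k[P]_{(P)}` and `B = k[P']_{(P')}` for algebraically independent points `P, P' ∈ L³`; suppose
the coordinates of `P` are polynomials in `P'` without constant term (so `A ⊆ B`, dominated),
`u = P_a/P_b ∈ B` for two distinct coordinates `P_a, P_b` of `A` (listed with the third one as a
system of generators of `𝔪_A`), and every coordinate of `P'` lies in `A[u]`. Then `B = A[u]_𝔭`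
is a simple extension of `A` in Sally's sense. [cite: Sally1972, Def. 4.1] -/
theorem isStrictSimpleExtension_originLocalRing {P P' : Fin 3 → L}
    (hP : AlgebraicIndependent k P) (hP' : AlgebraicIndependent k P')
    (hpoly : ∀ j, ∃ Q : MvPolynomial (Fin 3) k, constantCoeff Q = 0 ∧ P j = aeval P' Q)
    {a b c : Fin 3}
    (hspan : (haveI := isLocalRing_originLocalRing hP; maximalIdeal (originLocalRing hP)) =
      Ideal.span {originCoord hP a, originCoord hP b, originCoord hP c})
    (hu : P a / P b ∈ originLocalRing hP')
    (hgen : ∀ j, P' j ∈ adjoinElem (originLocalRing hP).toSubring (P a / P b)) :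
    IsStrictSimpleExtension (originLocalRing hP).toSubring (originLocalRing hP').toSubring := by
  haveI := isLocalRing_originLocalRing hP
  haveI := isLocalRing_originLocalRing hP'
  choose Q hQ0 hQ using hpoly
  have hmem : ∀ j, P j ∈ originLocalRing hP' := fun j => by
    rw [hQ j]; exact aeval_mem_originLocalRing hP' (Q j)
  have hmax : ∀ j, (⟨P j, hmem j⟩ : originLocalRing hP') ∈ maximalIdeal (originLocalRing hP') := by
    intro j
    have e : (⟨P j, hmem j⟩ : originLocalRing hP') =
        ⟨aeval P' (Q j), aeval_mem_originLocalRing hP' (Q j)⟩ := Subtype.ext (hQ j)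
    rw [e]
    exact Sally1972.aeval_mem_maximalIdeal hP' (hQ0 j)
  have hAB : originLocalRing hP ≤ originLocalRing hP' :=
    originLocalRing_le_of_forall_mem_maximalIdeal hP hP' hmem hmax
  haveI := isRegularLocalRing_originLocalRing hP
  have hindep : Sally1972.IndepModSq (originLocalRing hP) (originCoord hP a) (originCoord hP b) :=
    Sally1972.indepModSq_of_span_eq (ringKrullDim_originLocalRing hP) hspan
  have hAu : adjoinElem (originLocalRing hP).toSubring (P a / P b) ≤
      (originLocalRing hP').toSubring := by
    refine Subring.closure_le.mpr ?_
    rintro z (hz | rfl)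
    · exact hAB hz
    · exact hu
  refine ⟨isLocalRing_originLocalRing hP, originCoord hP a, originCoord hP b, hindep,
    isLocalRing_originLocalRing hP', hAu, fun z hz => ?_, ?_⟩
  · obtain ⟨F, G, hG, rfl⟩ := (mem_originLocalRing_iff hP').mp hz
    refine ⟨aeval P' F, aeval_mem_adjoinElem hgen F, aeval P' G, aeval_mem_adjoinElem hgen G, ?_,
      rfl⟩
    change (aeval P' G)⁻¹ ∈ originLocalRing hP'
    exact (mem_originLocalRing_iff hP').mpr ⟨1, G, hG, by rw [map_one, one_div]⟩
  · exact (ringKrullDim_originLocalRing hP').trans (ringKrullDim_originLocalRing hP).symm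

end Step

/-! ### The rings of Example 4.6 -/

namespace Sally1972

variable {k : Type u} [Field k] {L : Type v} [Field L] [Algebra k L]

/-- **`T` is not accessible from `R` in Sally's verbatim sense** (every field `k`, every ambient
field `L`): the first simple extension `R[p/q]_𝔭 ⊆ T` of a chain would put `p/q ∈ T`
(`div_not_mem_T`), and the empty chain is excluded by `R ≠ T`. [cite: Sally1972, Ex. 4.6]
[cite: Shannon1973] -/
theorem not_isStrictlyAccessible {v : Fin 3 → L} (hv : AlgebraicIndependent k v) :
    ¬ IsStrictlyAccessible (R hv).toSubring (T hv).toSubring := by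
  intro hacc
  rcases hacc.cases_head with hEq | ⟨R₁, h₁, hrest⟩
  · exact R_ne_T hv (Subalgebra.toSubring_injective hEq)
  · obtain ⟨_, p, q, hpq, hmem⟩ := h₁.exists_div_mem
    exact div_not_mem_T hv p.2 q.2 hpq ((IsStrictlyAccessible.le hrest) hmem)

variable (k) in
/-- The unit `e = 1 + X₁X₂³` (`= 1 + y z₁³`, so that `y² + z³ = y² e` for `z = y z₁`). [folklore] -/
def unitE : MvPolynomial (Fin 3) k := 1 + X 1 * X 2 ^ 3

/-- `e(0) = 1`. [folklore] -/
theorem constantCoeff_unitE : constantCoeff (unitE k) = 1 := by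
  simp [unitE]

/-- `e ≠ 0`. [folklore] -/
theorem unitE_ne_zero : unitE k ≠ 0 := fun h => by
  have := congrArg constantCoeff h
  rw [constantCoeff_unitE, map_zero] at this
  exact one_ne_zero this

/-- `e` does not involve `X₀`. [folklore] -/
theorem zero_notMem_vars_unitE : (0 : Fin 3) ∉ (unitE k).vars := by
  classical
  intro h
  rcases Finset.mem_union.mp (vars_add_subset _ _ h) with h1 | h1
  · rw [vars_one] at h1
    exact absurd h1 (Finset.notMem_empty _)
  · rcases Finset.mem_union.mp (vars_mul _ _ h1) with h2 | h2
    · rw [vars_X, Finset.mem_singleton] at h2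
      exact absurd h2 (by decide)
    · have h3 := vars_pow _ _ h2
      rw [vars_X, Finset.mem_singleton] at h3
      exact absurd h3 (by decide)

/-- `X₁` does not involve `X₂`. [folklore] -/
theorem two_notMem_vars_X_one : (2 : Fin 3) ∉ (X 1 : MvPolynomial (Fin 3) k).vars := by
  rw [vars_X, Finset.mem_singleton]; decide

/-- `X₁` does not involve `X₀`. [folklore] -/
theorem zero_notMem_vars_X_one : (0 : Fin 3) ∉ (X 1 : MvPolynomial (Fin 3) k).vars := by
  rw [vars_X, Finset.mem_singleton]; decide

variable (k) in
/-- From the base point `w = (t, y, z₁)`: the point `(t, y, z) = (t, y, y z₁)` of `T`.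
[cite: Sally1972, Ex. 4.6] -/
def ptT (w : Fin 3 → L) : Fin 3 → L := fun j => aeval w (mulSubst k 2 (X 1) (X j))

variable (k) in
/-- The point `(t e, y, z₁)`, `e = 1 + y z₁³`, of `S' = k[te, y, z₁]_{(te, y, z₁)}` (`= S`).
[cite: Sally1972, Ex. 4.6] -/
def ptS' (w : Fin 3 → L) : Fin 3 → L := fun j => aeval w (mulSubst k 0 (unitE k) (X j))

variable (k) in
/-- The point `(x₁, y, z₁) = (t y e, y, z₁)` of `R'' = R[x/y, z/y]_𝔭`. [cite: Sally1972, Ex. 4.6] -/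
def ptR'' (w : Fin 3 → L) : Fin 3 → L := fun j => aeval (ptS' k w) (mulSubst k 0 (X 1) (X j))

variable (k) in
/-- The point `(x₁, y, z) = (t y e, y, y z₁)` of `R' = R[x/y]_𝔭`. [cite: Sally1972, Ex. 4.6] -/
def ptR' (w : Fin 3 → L) : Fin 3 → L := fun j => aeval (ptR'' k w) (mulSubst k 2 (X 1) (X j))

variable {w : Fin 3 → L}

/-- `t`. [folklore] -/
@[simp] theorem ptT_zero : ptT k w 0 = w 0 := by simp [ptT]
/-- `y`. [folklore] -/
@[simp] theorem ptT_one : ptT k w 1 = w 1 := by simp [ptT]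
/-- `z = z₁ y`. [folklore] -/
@[simp] theorem ptT_two : ptT k w 2 = w 2 * w 1 := by simp [ptT]
/-- `t e`. [folklore] -/
@[simp] theorem ptS'_zero : ptS' k w 0 = w 0 * (1 + w 1 * w 2 ^ 3) := by
  simp [ptS', unitE, map_add, map_mul, map_pow]
/-- `y`. [folklore] -/
@[simp] theorem ptS'_one : ptS' k w 1 = w 1 := by simp [ptS']
/-- `z₁`. [folklore] -/
@[simp] theorem ptS'_two : ptS' k w 2 = w 2 := by simp [ptS']
/-- `x₁ = t e y`. [folklore] -/
@[simp] theorem ptR''_zero : ptR'' k w 0 = w 0 * (1 + w 1 * w 2 ^ 3) * w 1 := by simp [ptR'']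
/-- `y`. [folklore] -/
@[simp] theorem ptR''_one : ptR'' k w 1 = w 1 := by simp [ptR'']
/-- `z₁`. [folklore] -/
@[simp] theorem ptR''_two : ptR'' k w 2 = w 2 := by simp [ptR'']
/-- `x₁ = t e y`. [folklore] -/
@[simp] theorem ptR'_zero : ptR' k w 0 = w 0 * (1 + w 1 * w 2 ^ 3) * w 1 := by simp [ptR']
/-- `y`. [folklore] -/
@[simp] theorem ptR'_one : ptR' k w 1 = w 1 := by simp [ptR']
/-- `z = z₁ y`. [folklore] -/
@[simp] theorem ptR'_two : ptR' k w 2 = w 2 * w 1 := by simp [ptR']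

variable (hw : AlgebraicIndependent k w)
include hw

/-- `(t, y, y z₁)` is algebraically independent. [folklore] -/
theorem algebraicIndependent_ptT : AlgebraicIndependent k (ptT k w) :=
  algebraicIndependent_mulSubst hw 2 (X_ne_zero 1) two_notMem_vars_X_one

/-- `(t e, y, z₁)` is algebraically independent. [folklore] -/
theorem algebraicIndependent_ptS' : AlgebraicIndependent k (ptS' k w) :=
  algebraicIndependent_mulSubst hw 0 unitE_ne_zero zero_notMem_vars_unitE

/-- `(t y e, y, z₁)` is algebraically independent. [folklore] -/
theorem algebraicIndependent_ptR'' : AlgebraicIndependent k (ptR'' k w) :=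
  algebraicIndependent_mulSubst (algebraicIndependent_ptS' hw) 0 (X_ne_zero 1)
    zero_notMem_vars_X_one

/-- `(t y e, y, y z₁)` is algebraically independent. [folklore] -/
theorem algebraicIndependent_ptR' : AlgebraicIndependent k (ptR' k w) :=
  algebraicIndependent_mulSubst (algebraicIndependent_ptR'' hw) 2 (X_ne_zero 1)
    two_notMem_vars_X_one

/-- **`S = k[t, y, z₁]_{(t,y,z₁)}` is a strict simple extension of `T = k[t,y,z]_{(t,y,z)}`**
(`S = T[z/y]_𝔭`, `z/y = z₁`). [cite: Sally1972, Ex. 4.6] -/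
theorem isStrictSimpleExtension_T_S :
    IsStrictSimpleExtension (T (algebraicIndependent_ptT hw)).toSubring
      (originLocalRing hw).toSubring := by
  have h1 : w 1 ≠ 0 := hw.ne_zero 1
  refine isStrictSimpleExtension_originLocalRing (algebraicIndependent_ptT hw) hw
    (fun j => ⟨mulSubst k 2 (X 1) (X j), by fin_cases j <;> simp, rfl⟩) (a := 2) (b := 1) (c := 0)
    (maximalIdeal_originLocalRing_fin_three' _) ?_ fun j => ?_
  · rw [ptT_two, ptT_one, mul_div_cancel_right₀ _ h1]
    exact mem_originLocalRing_self hw 2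
  · fin_cases j
    · exact le_adjoinElem _ _ (by simpa using mem_originLocalRing_self (algebraicIndependent_ptT hw) 0)
    · exact le_adjoinElem _ _ (by simpa using mem_originLocalRing_self (algebraicIndependent_ptT hw) 1)
    · simpa [mul_div_cancel_right₀ _ h1] using
        mem_adjoinElem_self (T (algebraicIndependent_ptT hw)).toSubring (ptT k w 2 / ptT k w 1)

/-- **`S' = k[te, y, z₁]_{(te,y,z₁)}` is a strict simple extension of `R'' = k[x₁, y, z₁]`**
(`S' = R''[x₁/y]_𝔭`, `x₁/y = t e`). [cite: Sally1972, Ex. 4.6] -/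
theorem isStrictSimpleExtension_R''_S' :
    IsStrictSimpleExtension (originLocalRing (algebraicIndependent_ptR'' hw)).toSubring
      (originLocalRing (algebraicIndependent_ptS' hw)).toSubring := by
  have h1 : w 1 ≠ 0 := hw.ne_zero 1
  refine isStrictSimpleExtension_originLocalRing (algebraicIndependent_ptR'' hw)
    (algebraicIndependent_ptS' hw)
    (fun j => ⟨mulSubst k 0 (X 1) (X j), by fin_cases j <;> simp, rfl⟩) (a := 0) (b := 1) (c := 2)
    (maximalIdeal_originLocalRing_fin_three _) ?_ fun j => ?_
  · rw [ptR''_zero, ptR''_one, mul_div_cancel_right₀ _ h1]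
    simpa using mem_originLocalRing_self (algebraicIndependent_ptS' hw) 0
  · fin_cases j
    · simpa [mul_div_cancel_right₀ _ h1] using
        mem_adjoinElem_self (originLocalRing (algebraicIndependent_ptR'' hw)).toSubring
          (ptR'' k w 0 / ptR'' k w 1)
    · exact le_adjoinElem _ _ (by simpa using mem_originLocalRing_self (algebraicIndependent_ptR'' hw) 1)
    · exact le_adjoinElem _ _ (by simpa using mem_originLocalRing_self (algebraicIndependent_ptR'' hw) 2)

/-- **`R'' = k[x₁, y, z₁]` is a strict simple extension of `R' = k[x₁, y, z]`**
(`R'' = R'[z/y]_𝔭`). [cite: Sally1972, Ex. 4.6] -/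
theorem isStrictSimpleExtension_R'_R'' :
    IsStrictSimpleExtension (originLocalRing (algebraicIndependent_ptR' hw)).toSubring
      (originLocalRing (algebraicIndependent_ptR'' hw)).toSubring := by
  have h1 : w 1 ≠ 0 := hw.ne_zero 1
  refine isStrictSimpleExtension_originLocalRing (algebraicIndependent_ptR' hw)
    (algebraicIndependent_ptR'' hw)
    (fun j => ⟨mulSubst k 2 (X 1) (X j), by fin_cases j <;> simp, rfl⟩) (a := 2) (b := 1) (c := 0)
    (maximalIdeal_originLocalRing_fin_three' _) ?_ fun j => ?_
  · rw [ptR'_two, ptR'_one, mul_div_cancel_right₀ _ h1]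
    simpa using mem_originLocalRing_self (algebraicIndependent_ptR'' hw) 2
  · fin_cases j
    · exact le_adjoinElem _ _ (by simpa using mem_originLocalRing_self (algebraicIndependent_ptR' hw) 0)
    · exact le_adjoinElem _ _ (by simpa using mem_originLocalRing_self (algebraicIndependent_ptR' hw) 1)
    · simpa [mul_div_cancel_right₀ _ h1] using
        mem_adjoinElem_self (originLocalRing (algebraicIndependent_ptR' hw)).toSubring
          (ptR' k w 2 / ptR' k w 1)

/-- **`R' = k[x₁, y, z]` is a strict simple extension of `R = k[x, y, z]`** (`R' = R[x/y]_𝔭`,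
`x = x₁ y = t y² e = t(y² + z³)`). [cite: Sally1972, Ex. 4.6] -/
theorem isStrictSimpleExtension_R_R' :
    IsStrictSimpleExtension (R (algebraicIndependent_ptT hw)).toSubring
      (originLocalRing (algebraicIndependent_ptR' hw)).toSubring := by
  have h1 : w 1 ≠ 0 := hw.ne_zero 1
  have hx : xyz k (ptT k w) 0 = ptR' k w 0 * ptR' k w 1 := by
    rw [xyz_zero, ptT_zero, ptT_one, ptT_two, ptR'_zero, ptR'_one]; ring
  refine isStrictSimpleExtension_originLocalRing (algebraicIndependent_xyz (algebraicIndependent_ptT hw))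
    (algebraicIndependent_ptR' hw) (fun j => ?_) (a := 0) (b := 1) (c := 2)
    (maximalIdeal_originLocalRing_fin_three _) ?_ fun j => ?_
  · fin_cases j
    · exact ⟨X 0 * X 1, by simp, by rw [map_mul, aeval_X, aeval_X]; exact hx⟩
    · exact ⟨X 1, by simp, by simp [xyz_one]⟩
    · exact ⟨X 2, by simp, by simp [xyz_two]⟩
  · rw [hx, xyz_one, ptT_one, ← ptR'_one (k := k) (w := w), mul_div_cancel_right₀ _ (by simpa using h1)]
    exact mem_originLocalRing_self (algebraicIndependent_ptR' hw) 0
  · fin_cases j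
    · have e : ptR' k w 0 = xyz k (ptT k w) 0 / xyz k (ptT k w) 1 := by
        rw [hx, xyz_one, ptT_one, ← ptR'_one (k := k) (w := w), mul_div_cancel_right₀ _ (by simpa using h1)]
      simpa [e] using mem_adjoinElem_self (R (algebraicIndependent_ptT hw)).toSubring
        (xyz k (ptT k w) 0 / xyz k (ptT k w) 1)
    · exact le_adjoinElem _ _ (by
        simpa [xyz_one] using mem_originLocalRing_self (algebraicIndependent_xyz (algebraicIndependent_ptT hw)) 1)
    · exact le_adjoinElem _ _ (by
        simpa [xyz_two] using mem_originLocalRing_self (algebraicIndependent_xyz (algebraicIndependent_ptT hw)) 2)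

/-- `S' = S`: `k[te, y, z₁]_{(te,y,z₁)} = k[t, y, z₁]_{(t,y,z₁)}` since `e = 1 + y z₁³` is a unit of
both. [folklore] -/
theorem originLocalRing_ptS'_eq : originLocalRing (algebraicIndependent_ptS' hw) = originLocalRing hw := by
  have hS' := algebraicIndependent_ptS' hw
  haveI := isLocalRing_originLocalRing hw
  haveI := isLocalRing_originLocalRing hS'
  apply le_antisymm
  · -- coordinates of `S'` are polynomials in `w` without constant term
    have hmem : ∀ j, ptS' k w j ∈ originLocalRing hw := fun j =>
      aeval_mem_originLocalRing hw _
    refine originLocalRing_le_of_forall_mem_maximalIdeal hS' hw hmem fun j => ?_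
    exact aeval_mem_maximalIdeal hw (by fin_cases j <;> simp [unitE])
  · -- `t = (te)/e` with `e = e(P')` of constant term `1`
    have he : aeval (ptS' k w) (unitE k) = 1 + w 1 * w 2 ^ 3 := by
      simp [unitE, map_add, map_mul, map_pow]
    have he0 : (1 + w 1 * w 2 ^ 3 : L) ≠ 0 := by
      rw [← he]; exact aeval_ne_zero_of_constantCoeff_ne_zero hS' (by rw [constantCoeff_unitE]; exact one_ne_zero)
    have hQ : ∀ j, ∃ Q : MvPolynomial (Fin 3) k, constantCoeff Q = 0 ∧
        w j = aeval (ptS' k w) Q / aeval (ptS' k w) (unitE k) := by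
      intro j
      fin_cases j
      · exact ⟨X 0, constantCoeff_X k 0, by
          rw [aeval_X, he, ptS'_zero, mul_div_cancel_right₀ _ he0]; rfl⟩
      · exact ⟨X 1 * unitE k, by simp [constantCoeff_unitE], by
          rw [map_mul, aeval_X, he, ptS'_one, mul_div_cancel_right₀ _ he0]; rfl⟩
      · exact ⟨X 2 * unitE k, by simp [constantCoeff_unitE], by
          rw [map_mul, aeval_X, he, ptS'_two, mul_div_cancel_right₀ _ he0]; rfl⟩
    choose Q hQ0 hQ using hQ
    have hcc : constantCoeff (unitE k) ≠ 0 := by rw [constantCoeff_unitE]; exact one_ne_zero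
    have hmem : ∀ j, w j ∈ originLocalRing hS' := fun j => by
      rw [hQ j]; exact (mem_originLocalRing_iff hS').mpr ⟨Q j, unitE k, hcc, rfl⟩
    refine originLocalRing_le_of_forall_mem_maximalIdeal hw hS' hmem fun j => ?_
    have hmem' : aeval (ptS' k w) (Q j) / aeval (ptS' k w) (unitE k) ∈ originLocalRing hS' :=
      (mem_originLocalRing_iff hS').mpr ⟨Q j, unitE k, hcc, rfl⟩
    have e : (⟨w j, hmem j⟩ : originLocalRing hS') = ⟨_, hmem'⟩ := Subtype.ext (hQ j)
    rw [e, div_mem_maximalIdeal_originLocalRing_iff hS' (Q j) (unitE k) hcc hmem']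
    exact hQ0 j

/-- **The sandwich `R ⊂ T ⊂ S` of Sally's Example 4.6 (Shannon's example), with the tree's own
witness `S`**: for every field `k` and every algebraically independent `(t, y, z₁)` in a field
`L ⊇ k`, with `z = y z₁`, `x = t(y² + z³)`, `R = k[x,y,z]_{(x,y,z)}`, `T = k[t,y,z]_{(t,y,z)}`: the
three-dimensional regular local ring `S = k[t, y, z₁]_{(t,y,z₁)}` contains `T`, is accessible from `R`
(three simple extensions: adjoin `x/y`, then `z/y`, then `(x/y)/y`) and from `T` (one: adjoin `z/y`)
in Sally's verbatim sense, while `T` is NOT accessible from `R` — the printed ASSERTION "An accessible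
extension of `R` can have a regular local subring which is not accessible from `R`" (p. 297). The
printed WITNESS differs: Sally's `S = R[x/y, z/y, ((y + (z³/y))/(x/y))]_Q` has third generator
`(y + z³/y)/(x/y) = 1/t` and lives at the point `t ≡ 1` of the chart, her `T` being `R[x/(y²+z³)]_N`,
`N = Q ∩ R[x/(y²+z³)]`; the tree's `T` is the `t ≡ 0` instance of Thm. 4.4 (referee remarks
R-O2b-1/2 of the cell `pub-hironaka`). [cite: Sally1972, Ex. 4.6] [cite: Shannon1973] -/
theorem exists_accessible_overring :
    ∃ S : Subalgebra k L, IsRegularLocalRing S ∧ ringKrullDim S = 3 ∧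
      T (algebraicIndependent_ptT hw) ≤ S ∧
      IsStrictlyAccessible (R (algebraicIndependent_ptT hw)).toSubring S.toSubring ∧
      IsStrictlyAccessible (T (algebraicIndependent_ptT hw)).toSubring S.toSubring ∧
      ¬ IsStrictlyAccessible (R (algebraicIndependent_ptT hw)).toSubring
          (T (algebraicIndependent_ptT hw)).toSubring := by
  refine ⟨originLocalRing hw, isRegularLocalRing_originLocalRing hw, ringKrullDim_originLocalRing hw,
    fun z hz => (isStrictSimpleExtension_T_S hw).le hz, ?_,
    Relation.ReflTransGen.single (isStrictSimpleExtension_T_S hw), not_isStrictlyAccessible _⟩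
  have h3 := isStrictSimpleExtension_R''_S' hw
  rw [originLocalRing_ptS'_eq hw] at h3
  exact ((Relation.ReflTransGen.single (isStrictSimpleExtension_R_R' hw)).tail
    (isStrictSimpleExtension_R'_R'' hw)).tail h3

end Sally1972

end Literature.Barriers.ResolutionOfSingularities

end
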